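import Mathlib.Analysis.SpecialFunctions.Gamma.Basic
import Mathlib.Analysis.Normed.Ring.InfiniteSum
import Mathlib.Data.Nat.Choose.Vandermonde
import Mathlib.Data.Nat.Choose.Central
import Mathlib.Data.Nat.Choose.Sum
import Literature.Analysis.FunctionSpaces.BesselJProofs
import HarnessLib

/-!
# The power series of the product `J₀(x) J₁(x)` and its term-by-term Laplace transform

Family `hubbard` (support for the large-`U` series of the half-filled Lieb–Wu energy
`e(U) = -4 ∫₀^∞ J₀(ω) J₁(ω) dω / (ω (1 + e^{ωU/2}))`, Takahashi 1971; see
`Literature.Analysis.FunctionSpaces.LiebWuEnergyStrongCouplingSeries`).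

Watson, *A Treatise on the Theory of Bessel Functions*, §5.41 eq. (1) (held copy
`book:watsonnd-treatise-theory-bessel-functions` p. 141): multiplying the two absolutely convergent power
series and summing the finite inner sum by Vandermonde's theorem,
`J_μ(z) J_ν(z) = Σ_{m ≥ 0} (-)^m (z/2)^{μ+ν+2m} (μ+ν+m+1)_m / (m! Γ(μ+m+1) Γ(ν+m+1))`.
This file proves the case `μ = 0`, `ν = 1` for the tree's `Literature.Analysis.FunctionSpaces.besselJ`
(defined by its power series):

* `hasSum_besselJ01Term` — `J₀(x) J₁(x) = Σ_m (-1)^m β_m (x/2)^{2m+1}` with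
  `β_m = besselJ01Coeff m = C(2m+1, m)/(m! (m+1)!)` (`= (m+2)_m/(m! · m! · (m+1)!)`, Watson's coefficient);
* `hasSum_besselJ_zero_mul_one_div` — the same series for `J₀(x) J₁(x)/x`;
* `integral_pow_mul_exp_neg_mul_Ioi'` — `∫₀^∞ ω^k e^{-cω} dω = k!/c^{k+1}`;
* `hasSum_integral_exp_neg_mul_besselJ_zero_mul_one_div` — for `c > 2` the TERM-BY-TERM LAPLACE TRANSFORM
  `∫₀^∞ e^{-cω} J₀(ω) J₁(ω) dω/ω = Σ_m (-1)^m γ_m / c^{2m+1}`, `γ_m = besselJ01Moment m = β_m (2m)!/2^{2m+1}`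
  `= C(2m+1,m) C(2m,m)/((m+1) 2^{2m+1})`, an absolutely convergent series because `γ_m ≤ 4^m/(2(m+1))`
  (`besselJ01Moment_le`; central binomial bounds) — this is the step "integrating term by term" of
  Takahashi's derivation of the `1/U` expansion (Oitmaa–Hamer–Zheng 2006 §8.2.1 eq. (8.5)), valid exactly
  when `c > 2` (the product `J₀J₁` has exponential type `2`).

No named facts; helper lemmas are proved here.

## References

* G. N. Watson, *A Treatise on the Theory of Bessel Functions*, 2nd ed., CUP 1944, §5.41 eq. (1) (key `Watson1944`).
* J. Oitmaa, C. Hamer, W. Zheng, *Series Expansion Methods for Strongly Interacting Lattice Models*, CUP 2006,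
  §8.2.1 eqs. (8.5)–(8.7) (key `OitmaaHamerZheng2006`).
* M. Takahashi, Prog. Theor. Phys. 45 (1971) 756 (original derivation; cite-only).
-/

noncomputable section

open Filter Set Real Nat MeasureTheory Finset
open scoped Topology

namespace Literature.Analysis.FunctionSpaces

/-! ## The coefficients -/

/-- The coefficient `β_m = C(2m+1, m)/(m! (m+1)!)` of `(-1)^m (x/2)^{2m+1}` in the power series of
`J₀(x) J₁(x)`; Watson's `(μ+ν+m+1)_m/(m! Γ(μ+m+1) Γ(ν+m+1))` at `μ = 0`, `ν = 1`.
[cite: Watson1944, §5.41 eq. (1)] -/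
def besselJ01Coeff (m : ℕ) : ℝ :=
  (((2 * m + 1).choose m : ℕ) : ℝ) / ((m ! : ℝ) * ((m + 1)! : ℝ))

/-- The `m`-th term `(-1)^m β_m (x/2)^{2m+1}` of the power series of `J₀(x) J₁(x)`.
[cite: Watson1944, §5.41 eq. (1)] -/
def besselJ01Term (x : ℝ) (m : ℕ) : ℝ :=
  (-1) ^ m * besselJ01Coeff m * (x / 2) ^ (2 * m + 1)

/-- The Laplace moment `γ_m = β_m (2m)!/2^{2m+1}` of the `m`-th term:
`∫₀^∞ e^{-cω} [β_m (ω/2)^{2m+1}/ω] dω = γ_m / c^{2m+1}`.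
[cite: OitmaaHamerZheng2006, §8.2.1 eq. (8.5)] -/
def besselJ01Moment (m : ℕ) : ℝ :=
  besselJ01Coeff m * ((2 * m)! : ℝ) / 2 ^ (2 * m + 1)

/-- `β_m > 0`. [cite: Watson1944, §5.41 eq. (1)] -/
theorem besselJ01Coeff_pos (m : ℕ) : 0 < besselJ01Coeff m := by
  unfold besselJ01Coeff
  have : 0 < (2 * m + 1).choose m := Nat.choose_pos (by omega)
  positivity

/-- `β_0 = 1` (the leading term `J₀J₁ ≈ x/2`). [cite: Watson1944, §5.41 eq. (1)] -/
@[simp] theorem besselJ01Coeff_zero : besselJ01Coeff 0 = 1 := by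
  simp [besselJ01Coeff]

/-- `γ_m = C(2m+1, m) C(2m, m)/((m+1) 2^{2m+1})` (using `(2m)! = C(2m,m) (m!)²`).
[cite: OitmaaHamerZheng2006, §8.2.1 eq. (8.6)] -/
theorem besselJ01Moment_eq (m : ℕ) :
    besselJ01Moment m = (((2 * m + 1).choose m : ℕ) : ℝ) * (((2 * m).choose m : ℕ) : ℝ) /
      (((m : ℝ) + 1) * 2 ^ (2 * m + 1)) := by
  have h2m : (((2 * m).choose m : ℕ) : ℝ) * (m ! : ℝ) * (m ! : ℝ) = ((2 * m)! : ℝ) := by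
    have := Nat.choose_mul_factorial_mul_factorial (show m ≤ 2 * m by omega)
    rw [show 2 * m - m = m by omega] at this
    exact_mod_cast this
  have hm1 : (((m + 1)! : ℕ) : ℝ) = ((m : ℝ) + 1) * (m ! : ℝ) := by
    rw [Nat.factorial_succ]; push_cast; ring
  unfold besselJ01Moment besselJ01Coeff
  rw [← h2m, hm1]
  have hf : (0 : ℝ) < m ! := by positivity
  field_simp

/-- `γ_0 = 1/2` (`∫₀^∞ e^{-cω} (1/2) dω = 1/(2c)` is the leading term). [cite: OitmaaHamerZheng2006, §8.2.1 eq. (8.5)] -/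
@[simp] theorem besselJ01Moment_zero : besselJ01Moment 0 = 1 / 2 := by
  simp [besselJ01Moment]

/-- `γ_m > 0`. [cite: OitmaaHamerZheng2006, §8.2.1 eq. (8.6)] -/
theorem besselJ01Moment_pos (m : ℕ) : 0 < besselJ01Moment m := by
  unfold besselJ01Moment
  have := besselJ01Coeff_pos m
  positivity

/-- **Growth of the Laplace moments**: `γ_m ≤ 4^m/(2(m+1))` (from `C(2m+1,m) ≤ 4^m`, `C(2m,m) ≤ 4^m`);
hence `Σ_m γ_m c^{-(2m+1)}` converges for `c > 2`. [cite: OitmaaHamerZheng2006, §8.2.1 eq. (8.6)] -/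
theorem besselJ01Moment_le (m : ℕ) : besselJ01Moment m ≤ 4 ^ m / (2 * ((m : ℝ) + 1)) := by
  rw [besselJ01Moment_eq]
  have h1 : (((2 * m + 1).choose m : ℕ) : ℝ) ≤ 4 ^ m := by exact_mod_cast Nat.choose_middle_le_pow m
  have h2 : (((2 * m).choose m : ℕ) : ℝ) ≤ 4 ^ m := by
    have := Nat.centralBinom_le_four_pow m
    rw [Nat.centralBinom_eq_two_mul_choose] at this
    exact_mod_cast this
  have hm : (0 : ℝ) < (m : ℝ) + 1 := by positivity
  rw [div_le_div_iff₀ (by positivity) (by positivity)]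
  calc (((2 * m + 1).choose m : ℕ) : ℝ) * (((2 * m).choose m : ℕ) : ℝ) * (2 * ((m : ℝ) + 1))
      ≤ 4 ^ m * 4 ^ m * (2 * ((m : ℝ) + 1)) := by gcongr
    _ = 4 ^ m * (((m : ℝ) + 1) * 2 ^ (2 * m + 1)) := by rw [pow_succ, pow_mul]; norm_num; ring

/-! ## The product series (Watson §5.41 (1) at `μ = 0`, `ν = 1`) -/

/-- The product of the `i`-th term of `J₀` and the `j`-th term of `J₁`, written over the common
denominator `(i+j)! (i+j+1)!`:
`T⁰_i T¹_j = (-1)^{i+j} (x/2)^{2(i+j)+1} C(i+j+1, i) C(i+j, j) / ((i+j)! (i+j+1)!)`. [cite: Watson1944, §5.41] -/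
theorem besselJTerm_zero_mul_besselJTerm_one (x : ℝ) (i j : ℕ) :
    besselJTerm 0 x i * besselJTerm 1 x j =
      (-1) ^ (i + j) * (x / 2) ^ (2 * (i + j) + 1) *
        ((((i + j + 1).choose i : ℕ) : ℝ) * (((i + j).choose j : ℕ) : ℝ) /
          (((i + j)! : ℝ) * ((i + j + 1)! : ℝ))) := by
  have h1 : (((i + j).choose j : ℕ) : ℝ) * (i ! : ℝ) * (j ! : ℝ) = ((i + j)! : ℝ) := by
    exact_mod_cast Nat.add_choose_mul_factorial_mul_factorial i j
  have h2 : (((i + j + 1).choose i : ℕ) : ℝ) * ((j + 1)! : ℝ) * (i ! : ℝ) = ((i + j + 1)! : ℝ) := by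
    have := Nat.add_choose_mul_factorial_mul_factorial (j + 1) i
    rw [show j + 1 + i = i + j + 1 by omega] at this
    exact_mod_cast this
  have hi : (0 : ℝ) < i ! := by positivity
  have hj : (0 : ℝ) < j ! := by positivity
  have hj1 : (0 : ℝ) < (j + 1)! := by positivity
  have hc1 : (0 : ℝ) < (((i + j).choose j : ℕ) : ℝ) := by exact_mod_cast Nat.choose_pos (by omega)
  have hc2 : (0 : ℝ) < (((i + j + 1).choose i : ℕ) : ℝ) := by exact_mod_cast Nat.choose_pos (by omega)
  rw [← h1, ← h2]
  simp only [besselJTerm, add_zero]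
  field_simp
  ring

/-- The finite inner sum (Vandermonde): `Σ_{i+j=m} T⁰_i(x) T¹_j(x) = (-1)^m β_m (x/2)^{2m+1}`.
[cite: Watson1944, §5.41 eq. (1)] -/
theorem sum_antidiagonal_besselJTerm_zero_mul_one (x : ℝ) (m : ℕ) :
    ∑ kl ∈ antidiagonal m, besselJTerm 0 x kl.1 * besselJTerm 1 x kl.2 = besselJ01Term x m := by
  have hV : (((2 * m + 1).choose m : ℕ) : ℝ) =
      ∑ kl ∈ antidiagonal m, (((m + 1).choose kl.1 : ℕ) : ℝ) * ((m.choose kl.2 : ℕ) : ℝ) := by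
    have h := Nat.add_choose_eq (m + 1) m m
    rw [show m + 1 + m = 2 * m + 1 by ring] at h
    rw [h]
    push_cast
    rfl
  calc ∑ kl ∈ antidiagonal m, besselJTerm 0 x kl.1 * besselJTerm 1 x kl.2
      = ∑ kl ∈ antidiagonal m, (-1) ^ m * (x / 2) ^ (2 * m + 1) *
          ((((m + 1).choose kl.1 : ℕ) : ℝ) * ((m.choose kl.2 : ℕ) : ℝ) /
            ((m ! : ℝ) * ((m + 1)! : ℝ))) := by
        refine Finset.sum_congr rfl fun kl hkl => ?_
        rw [mem_antidiagonal] at hkl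
        rw [besselJTerm_zero_mul_besselJTerm_one, ← hkl]
    _ = (-1) ^ m * (x / 2) ^ (2 * m + 1) *
          ((((2 * m + 1).choose m : ℕ) : ℝ) / ((m ! : ℝ) * ((m + 1)! : ℝ))) := by
        rw [← Finset.mul_sum, ← Finset.sum_div, ← hV]
    _ = besselJ01Term x m := by
        unfold besselJ01Term besselJ01Coeff
        ring

/-- **Watson §5.41 (1) for `J₀ J₁`**: for every real `x`,
`J₀(x) J₁(x) = Σ_{m ≥ 0} (-1)^m C(2m+1,m)/(m!(m+1)!) (x/2)^{2m+1}` (Cauchy product of the two absolutely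
convergent series, inner sums by Vandermonde's theorem). [cite: Watson1944, §5.41 eq. (1)] -/
theorem hasSum_besselJ01Term (x : ℝ) : HasSum (besselJ01Term x) (besselJ 0 x * besselJ 1 x) := by
  have hf : Summable fun i => ‖besselJTerm 0 x i‖ := by
    simpa only [Real.norm_eq_abs] using summable_abs_iff.mpr (summable_besselJTerm_holds 0 x)
  have hg : Summable fun i => ‖besselJTerm 1 x i‖ := by
    simpa only [Real.norm_eq_abs] using summable_abs_iff.mpr (summable_besselJTerm_holds 1 x)
  have hprod := tsum_mul_tsum_eq_tsum_sum_antidiagonal_of_summable_norm hf hg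
  have hsum : Summable fun n => ∑ kl ∈ antidiagonal n, besselJTerm 0 x kl.1 * besselJTerm 1 x kl.2 :=
    summable_sum_mul_antidiagonal_of_summable_norm' hf (summable_besselJTerm_holds 0 x) hg
      (summable_besselJTerm_holds 1 x)
  have e : (fun n => ∑ kl ∈ antidiagonal n, besselJTerm 0 x kl.1 * besselJTerm 1 x kl.2) =
      besselJ01Term x := funext (sum_antidiagonal_besselJTerm_zero_mul_one x)
  rw [e] at hsum hprod
  have hJ : besselJ 0 x * besselJ 1 x = ∑' n, besselJ01Term x n := hprod
  rw [hJ]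
  exact hsum.hasSum

/-- The product series divided by `x`: for `x ≠ 0`,
`J₀(x) J₁(x)/x = Σ_m (-1)^m β_m x^{2m}/2^{2m+1}` (an even entire function with value `1/2` at `0`).
[cite: Watson1944, §5.41 eq. (1)] -/
theorem hasSum_besselJ_zero_mul_one_div {x : ℝ} (hx : x ≠ 0) :
    HasSum (fun m => (-1) ^ m * besselJ01Coeff m / 2 ^ (2 * m + 1) * x ^ (2 * m))
      (besselJ 0 x * besselJ 1 x / x) := by
  have h := (hasSum_besselJ01Term x).div_const x
  have e : (fun m => besselJ01Term x m / x) =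
      fun m => (-1) ^ m * besselJ01Coeff m / 2 ^ (2 * m + 1) * x ^ (2 * m) := by
    funext m
    simp only [besselJ01Term]
    rw [div_pow]
    field_simp
    ring
  rw [e] at h
  exact h

/-! ## Term-by-term Laplace transform -/

/-- `∫₀^∞ ω^k e^{-cω} dω = k!/c^{k+1}` for `c > 0`, with integrability (Euler's integral,
Mathlib's `integral_rpow_mul_exp_neg_mul_Ioi` at the natural exponent `k + 1`). [cite: DLMF, 5.2.1] -/
theorem integral_pow_mul_exp_neg_mul_Ioi' {c : ℝ} (hc : 0 < c) (k : ℕ) :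
    IntegrableOn (fun ω : ℝ => ω ^ k * Real.exp (-(c * ω))) (Ioi 0) ∧
      ∫ ω in Ioi (0 : ℝ), ω ^ k * Real.exp (-(c * ω)) = (k ! : ℝ) / c ^ (k + 1) := by
  have hval := integral_rpow_mul_exp_neg_mul_Ioi (a := (k : ℝ) + 1) (r := c) (by positivity) hc
  have hnn : ∀ ω ∈ Ioi (0 : ℝ),
      ω ^ ((k : ℝ) + 1 - 1) * Real.exp (-(c * ω)) = ω ^ k * Real.exp (-(c * ω)) := by
    intro ω _
    rw [add_sub_cancel_right, Real.rpow_natCast]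
  have hG : (1 / c) ^ ((k : ℝ) + 1) * Real.Gamma ((k : ℝ) + 1) = (k ! : ℝ) / c ^ (k + 1) := by
    rw [Real.Gamma_nat_eq_factorial, show ((k : ℝ) + 1) = ((k + 1 : ℕ) : ℝ) by push_cast; ring,
      Real.rpow_natCast, one_div, inv_pow]
    field_simp
  have hpos : 0 < (1 / c) ^ ((k : ℝ) + 1) * Real.Gamma ((k : ℝ) + 1) := by
    rw [hG]; positivity
  have hI : IntegrableOn (fun ω : ℝ => ω ^ ((k : ℝ) + 1 - 1) * Real.exp (-(c * ω))) (Ioi 0) := by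
    by_contra hni
    have := integral_undef hni
    rw [hval] at this
    exact hpos.ne' this
  refine ⟨hI.congr_fun hnn measurableSet_Ioi, ?_⟩
  rw [← setIntegral_congr_fun measurableSet_Ioi hnn, hval, hG]

/-- **Term-by-term Laplace transform of `J₀J₁/ω`** (Takahashi's step): for `c > 2`,
`∫₀^∞ e^{-cω} J₀(ω) J₁(ω) dω/ω = Σ_{m ≥ 0} (-1)^m γ_m / c^{2m+1}`, `γ_m = besselJ01Moment m`, the series
converging absolutely (`γ_m/c^{2m+1} ≤ (4/c²)^m/(2c)`); interchange by `Σ_m ∫ |term_m| < ∞`.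
[cite: OitmaaHamerZheng2006, §8.2.1 eq. (8.5)] -/
theorem hasSum_integral_exp_neg_mul_besselJ_zero_mul_one_div {c : ℝ} (hc : 2 < c) :
    HasSum (fun m => (-1) ^ m * besselJ01Moment m / c ^ (2 * m + 1))
      (∫ ω in Ioi (0 : ℝ), Real.exp (-(c * ω)) * (besselJ 0 ω * besselJ 1 ω / ω)) := by
  have hc0 : 0 < c := by linarith
  -- the terms
  set F : ℕ → ℝ → ℝ := fun m ω =>
    Real.exp (-(c * ω)) * ((-1) ^ m * besselJ01Coeff m / 2 ^ (2 * m + 1) * ω ^ (2 * m)) with hF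
  have hFshape : ∀ m, F m = fun ω => ((-1) ^ m * besselJ01Coeff m / 2 ^ (2 * m + 1)) *
      (ω ^ (2 * m) * Real.exp (-(c * ω))) := by
    intro m; funext ω; simp only [hF]; ring
  have hpow := fun m => integral_pow_mul_exp_neg_mul_Ioi' hc0 (2 * m)
  have hF_int : ∀ m, Integrable (F m) (volume.restrict (Ioi (0 : ℝ))) := by
    intro m
    rw [hFshape m]
    exact ((hpow m).1).const_mul _
  -- the integrals of the terms and of their norms
  have hF_val : ∀ m, ∫ ω in Ioi (0 : ℝ), F m ω = (-1) ^ m * besselJ01Moment m / c ^ (2 * m + 1) := by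
    intro m
    rw [hFshape m, MeasureTheory.integral_const_mul, (hpow m).2, besselJ01Moment]
    field_simp
  have hF_norm : ∀ m, ∫ ω in Ioi (0 : ℝ), ‖F m ω‖ = besselJ01Moment m / c ^ (2 * m + 1) := by
    intro m
    have e : (fun ω => ‖F m ω‖) = fun ω => (besselJ01Coeff m / 2 ^ (2 * m + 1)) *
        (ω ^ (2 * m) * Real.exp (-(c * ω))) := by
      funext ω
      rw [hFshape m]
      simp only
      rw [Real.norm_eq_abs, abs_mul, abs_mul, abs_div, abs_mul, abs_pow, abs_neg, abs_one, one_pow,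
        one_mul, abs_of_pos (besselJ01Coeff_pos m), abs_of_pos (by positivity : (0 : ℝ) < 2 ^ (2 * m + 1)),
        abs_of_nonneg ((even_two_mul m).pow_nonneg ω), Real.abs_exp]
    rw [e, MeasureTheory.integral_const_mul, (hpow m).2, besselJ01Moment]
    field_simp
  -- summability of the norms: comparison with the geometric series of ratio 4/c²
  have hr : 4 / c ^ 2 < 1 := by
    rw [div_lt_one (by positivity)]
    nlinarith
  have hF_sum : Summable fun m => ∫ ω in Ioi (0 : ℝ), ‖F m ω‖ := by
    simp_rw [hF_norm]
    refine Summable.of_nonneg_of_le (fun m => by have := besselJ01Moment_pos m; positivity)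
      (fun m => ?_) (((summable_geometric_of_lt_one (by positivity) hr)).mul_left (1 / (2 * c)))
    have hm : (0 : ℝ) < (m : ℝ) + 1 := by positivity
    calc besselJ01Moment m / c ^ (2 * m + 1) ≤ (4 ^ m / (2 * ((m : ℝ) + 1))) / c ^ (2 * m + 1) := by
          gcongr; exact besselJ01Moment_le m
      _ ≤ (4 ^ m / 2) / c ^ (2 * m + 1) := by
          gcongr
          · linarith
      _ = 1 / (2 * c) * (4 / c ^ 2) ^ m := by
          rw [div_pow, pow_succ, pow_mul]
          field_simp
  -- the pointwise sum on `(0, ∞)`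
  have hpt : ∀ ω ∈ Ioi (0 : ℝ),
      ∑' m, F m ω = Real.exp (-(c * ω)) * (besselJ 0 ω * besselJ 1 ω / ω) := by
    intro ω hω
    have h := (hasSum_besselJ_zero_mul_one_div (ne_of_gt hω)).mul_left (Real.exp (-(c * ω)))
    exact h.tsum_eq
  have hmain := hasSum_integral_of_summable_integral_norm hF_int hF_sum
  rw [setIntegral_congr_fun measurableSet_Ioi hpt] at hmain
  simp_rw [hF_val] at hmain
  exact hmain

/-- Corollary: the value as a `tsum`. [cite: OitmaaHamerZheng2006, §8.2.1 eq. (8.5)] -/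
theorem integral_exp_neg_mul_besselJ_zero_mul_one_div_eq_tsum {c : ℝ} (hc : 2 < c) :
    ∫ ω in Ioi (0 : ℝ), Real.exp (-(c * ω)) * (besselJ 0 ω * besselJ 1 ω / ω) =
      ∑' m, (-1) ^ m * besselJ01Moment m / c ^ (2 * m + 1) :=
  (hasSum_integral_exp_neg_mul_besselJ_zero_mul_one_div hc).tsum_eq.symm

/-- Absolute summability of the Laplace series for `c > 2`, with the geometric majorant
`γ_m/c^{2m+1} ≤ (4/c²)^m/(2c)`. [cite: OitmaaHamerZheng2006, §8.2.1 eq. (8.5)] -/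
theorem besselJ01Moment_div_pow_le {c : ℝ} (hc : 0 < c) (m : ℕ) :
    besselJ01Moment m / c ^ (2 * m + 1) ≤ (4 / c ^ 2) ^ m / (2 * c) := by
  have hm : (0 : ℝ) < (m : ℝ) + 1 := by positivity
  calc besselJ01Moment m / c ^ (2 * m + 1) ≤ (4 ^ m / (2 * ((m : ℝ) + 1))) / c ^ (2 * m + 1) := by
        gcongr; exact besselJ01Moment_le m
    _ ≤ (4 ^ m / 2) / c ^ (2 * m + 1) := by
        gcongr
        · linarith
    _ = (4 / c ^ 2) ^ m / (2 * c) := by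
        rw [div_pow, pow_succ, pow_mul]
        field_simp

end Literature.Analysis.FunctionSpaces
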